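import Literature.AnabelianGeometry.AbsoluteAnabelian.LocalReciprocityTransferTheta
import Literature.AnabelianGeometry.AbsoluteAnabelian.AbsAnabLevelReciprocityProofs
import Literature.AnabelianGeometry.AbsoluteAnabelian.AbsAnabLevelFieldsProofs
import Literature.AnabelianGeometry.AbsoluteAnabelian.MLFReciprocityEquivariantProofs
import Literature.AnabelianGeometry.AbsoluteAnabelian.MLFReciprocityCharacterizedGeneral
import Literature.AnabelianGeometry.AbsoluteAnabelian.MLFGaloisGroupsProofs
import Literature.AnabelianGeometry.AbsoluteAnabelian.GaloisCyclotomeFunctoriality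
import Literature.NumberTheory.GaloisRepresentations.LocalReciprocityThetaUnique
import Literature.NumberTheory.GaloisRepresentations.AbsGaloisTransfer
import Literature.NumberTheory.GaloisRepresentations.AbsGaloisGroupProofs
import Mathlib.Topology.Algebra.Category.ProfiniteGrp.Completion
import HarnessLib

/-!
# The local transfer theorem in the `Γ_K^ab` presentation:
# `Ver_{E/F} (θ_F u) = θ_E (u)` and `e_E ∘ (Fˣ)^∧→(Eˣ)^∧ = Ver_{E/F} ∘ e_F`

abc-iut cell, layer L4, row «COR110ib-OPEN» (abc-iut-L4-t11; L4-lead RULING #6g) — square (S3), the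
reciprocity/Verlagerung leg of the open-injective functoriality of [AbsTopIII] Cor. 1.10 (i)(b) p. 42
(S. Mochizuki, *Topics in Absolute Anabelian Geometry III*: «the asserted "functoriality" is with respect
to arbitrary injective open homomorphisms of profinite groups»; [AbsAnab] Prop. 1.2.1 proof p. 11: the
transition maps are «the Verlagerung»).  PRINT: J. Neukirch, *Algebraic Number Theory* IV (5.9) p. 271:
for `K ⊆ K'`, `r_{L|K'} ∘ Ver = incl ∘ r_{L|K}` — the reciprocity maps commute with the transfer.

The tree proved (5.9) INSIDE `Γ_F` (abc-iut-L4-t11 `verlagerung_apply_eq_of_characterized`,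
`LocalReciprocityTransferTheta.lean`: levels `Gal(F̄/E₀) ≥ Gal(F̄/E'₀)` of one absolute Galois group, Artin
maps characterised by the shadows of Serre's `θ`).  The consumers of Cor. 1.10 (abc-iut-L4-d3's naturality
family `Cor110Nat.*`, abc-iut-L4-d1's `kummerTate`) work in the SELF presentation: each MLF `k` with its own
`Γ_k = Gal(k̄/k)`, `θ_k := (isReciprocitySystemE (F := k) (E := k) (isClassFieldTheory_localWeilDatum k)).theta`
(Serre's `x ↦ (x, */k)` in Neukirch's Weil datum of `k`), and for a finite `E/F` the Verlagerung
`Literature.NumberTheory.GaloisRepresentations.verlagerung F E : Γ_F^ab →ₜ* Γ_E^ab` along the injective open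
homomorphism `res : Γ_E ↪ Γ_F` (`AbsGaloisTransfer.lean`).  This PROOF-ONLY file transports (5.9) there:

* `galFixing_embField_eq_range` — `Gal(F̄/E₀) = res(Γ_E)`;
* `absGaloisAbProj_liftGal_self'` — at the trivial level `liftGal F F` is inner, the identity on `Γ_F^ab`
  (universe-polymorphic copy of abc-iut-L4-d3's `Cor110Nat.absGaloisAbProj_liftGal_self`);
* `absGaloisTransfer_eq_of_transfer_mk` — the two transfers agree: if the subgroup-level Verlagerung
  `Gal(F̄/F₀)^ab → Gal(F̄/E₀)^ab` (`GaloisCyclotome.lean`) sends `[h₀]` to `[h₁]`, then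
  `absGaloisTransfer F E h₀ = [liftGal h₁]` in `Γ_E^ab` (naturality of Mathlib's `MonoidHom.transfer`
  under the isomorphisms `Gal(F̄/F₀) = Γ_F`, `Gal(F̄/E₀) ≅ Γ_E`);
* **`verlagerung_canonicalTheta`** — `Ver_{E/F} (θ_F u) = θ_E (u)` for `u ∈ Fˣ` read in `Eˣ`
  (Neukirch IV (5.9) in the self presentation; uses the BASE INDEPENDENCE `θ_E` over `F` = `θ_E` over
  `E`, `LocalWeilDatum.theta_recSystemE_eq_self`, i.e. the uniqueness of Serre's `θ`);
* **`completionEquiv_verlagerung`** — on the profinite completions: for `Ψ : (Fˣ)^∧ →ₜ* (Eˣ)^∧` over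
  `Fˣ ⊆ Eˣ` and `e_F, e_E` extending `θ_F, θ_E` (abc-iut-L4-d3's binder shapes `he₁/he₂` verbatim),
  `e_E (Ψ x) = Ver_{E/F} (e_F x)` (density of `η(Fˣ)`).

Theorems only (no definition, no named fact, no `sorry`); classical local class field theory.  HONEST
FRAMING: nothing here bears on [IUTchIII] Cor. 3.12 or takes a side.
-/

noncomputable section

open Field IsNonarchimedeanLocalField ValuativeRel Topology
open scoped Pointwise

namespace Literature.AnabelianGeometry.AbsoluteAnabelian

open Literature.NumberTheory.GaloisRepresentations
open Literature.NumberTheory.GaloisRepresentations.LocalWeilDatum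
open AbstractCFT AbstractCFT.WeilDatum

/-! ### Pure group theory: transfers along equal subgroups -/

section TransferCongr

variable {G A : Type*} [Group G] [CommGroup A]

/-- Transfers of pointwise-equal homomorphisms on EQUAL finite-index subgroups coincide (the subgroup
and the `FiniteIndex` instance enter `MonoidHom.transfer` only through the function).
[cite: NeukirchANT1999, Ch. IV §5 p. 271 (definition of Ver)] -/
theorem transfer_congr_of_eq {H₁ H₂ : Subgroup G} [h₁ : H₁.FiniteIndex] [h₂ : H₂.FiniteIndex]
    (hH : H₁ = H₂) (ϕ₁ : H₁ →* A) (ϕ₂ : H₂ →* A)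
    (hϕ : ∀ (x : G) (hx : x ∈ H₁), ϕ₁ ⟨x, hx⟩ = ϕ₂ ⟨x, hH ▸ hx⟩) (g : G) :
    MonoidHom.transfer ϕ₁ g = MonoidHom.transfer ϕ₂ g := by
  subst hH
  have hϕ' : ϕ₁ = ϕ₂ := MonoidHom.ext fun x => hϕ x.1 x.2
  subst hϕ'
  rfl

end TransferCongr

/-! ### `Gal(F̄/E₀) = res(Γ_E)` and the trivial level -/

section Levels

variable (F E : Type*) [Field F] [Field E] [Algebra F E] [Algebra.IsAlgebraic F E]

/-- **`Gal(F̄/E₀) = res(Γ_E)`**: the subgroup of `Γ_F` fixing `E₀ = ι⁻¹(E)` is the image of the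
injective open homomorphism `res : Γ_E → Γ_F` (`absGaloisRestrict_mem_galFixing`; conversely
`γ = res (liftGal γ)`). [cite: NeukirchANT1999, Ch. IV §5 p. 271 (definition of Ver)] -/
theorem galFixing_embField_eq_range :
    galFixing F (embField F E) = (absGaloisRestrict F E).range := by
  ext γ
  constructor
  · intro hγ
    exact ⟨liftGal F E hγ, absGaloisRestrict_liftGal F E hγ⟩
  · rintro ⟨σ, rfl⟩
    exact absGaloisRestrict_mem_galFixing F E σ

variable {F} in
/-- **`liftGal F F` is the identity on `Γ_F^ab`**: the restriction `absGaloisRestrict F F` along the chosen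
`F̄ ≃ₐ[F] F̄` is an inner automorphism (`absGaloisRestrict_isConj_of_algHom_holds` with `ι' = id`), so its
inverse `liftGal F F` on `Gal(F̄/F₀) = Γ_F` does not move classes in the topological abelianisation
(universe-polymorphic form of abc-iut-L4-d3's `Cor110Nat.absGaloisAbProj_liftGal_self`).
[cite: MochizukiAbsAnab2004, §1.2 p.9] -/
theorem absGaloisAbProj_liftGal_self' {γ : absoluteGaloisGroup F} (hγ : γ ∈ galFixing F (embField F F)) :
    absGaloisAbProj F (liftGal F F hγ) = absGaloisAbProj F γ := by
  obtain ⟨σ₀, hσ₀⟩ := absGaloisRestrict_isConj_of_algHom_holds F F (AlgHom.id F (AlgebraicClosure F)) id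
    (fun _ _ => rfl)
  have h := absGaloisRestrict_liftGal F F hγ
  have hc : liftGal F F hγ = σ₀ * γ * σ₀⁻¹ := by
    have := hσ₀ (liftGal F F hγ)
    rw [h] at this
    exact this.symm ▸ rfl
  rw [hc, map_mul, map_mul, mul_right_comm, ← map_mul, mul_inv_cancel, map_one, one_mul]

end Levels

/-! ### The two transfers agree -/

section Transfers

variable (F E : Type*) [Field F] [CharZero F] [Field E] [Algebra F E] [FiniteDimensional F E]

/-- **The subgroup-level Verlagerung of `Γ_F` and the field-level Verlagerung `Ver_{E/F}` agree.**  If the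
transfer `Gal(F̄/F₀) → Gal(F̄/E₀)^ab` of `GaloisCyclotome.lean` (`transferToAbelianization`, the map the
subgroup-level `verlagerung` descends) sends `h₀` to the class `[h₁]`, then Neukirch's field-level transfer
`absGaloisTransfer F E : Γ_F → Γ_E^ab` (`AbsGaloisTransfer.lean`, along `res : Γ_E ↪ Γ_F`) sends `h₀`
to `[liftGal h₁] ∈ Γ_E^ab`.  Both are Mathlib's `MonoidHom.transfer`, for the subgroup
`Gal(F̄/E₀) = res(Γ_E)` of `Gal(F̄/F₀) = Γ_F`, of homomorphisms that agree after `Gal(F̄/E₀) ≅ Γ_E`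
(`transfer_comp_mulEquiv`, `map_transfer`). [cite: NeukirchANT1999, Ch. IV §5 p. 271 (definition of Ver)] -/
theorem absGaloisTransfer_eq_of_transfer_mk
    (h₀ : galFixing F (embField F F)) (h₁ : galFixing F (embField F E))
    (hver : haveI : CompactSpace (absoluteGaloisGroup F) := absoluteGaloisGroup_compactSpace F
      haveI := finiteDimensional_embField F E
      haveI := finiteDimensional_embField F F
      transferToAbelianization (isOpen_galFixing F (embField F F)) (isOpen_galFixing F (embField F E))
        (galFixing_antitone F (embField_self_le (embField F E))) h₀ = QuotientGroup.mk h₁) :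
    absGaloisTransfer F E (h₀ : absoluteGaloisGroup F) = absGaloisAbProj E (liftGal F E h₁.2) := by
  classical
  haveI : CompactSpace (absoluteGaloisGroup F) := absoluteGaloisGroup_compactSpace F
  haveI := finiteDimensional_embField F E
  haveI := finiteDimensional_embField F F
  have hle : galFixing F (embField F E) ≤ galFixing F (embField F F) :=
    galFixing_antitone F (embField_self_le (embField F E))
  -- `Gal(F̄/E₀) ≅ Γ_E` and the induced isomorphism of topological abelianisations
  obtain ⟨Φ, hΦ⟩ := exists_continuousMulEquiv_galFixing_embField F E
  obtain ⟨ê, hê⟩ := exists_mulEquiv_topologicalAbelianization Φ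
  -- `Gal(F̄/F₀) = Γ_F` as a group isomorphism
  let e : galFixing F (embField F F) ≃* absoluteGaloisGroup F :=
    { toFun := fun h => (h : absoluteGaloisGroup F)
      invFun := fun γ => ⟨γ, mem_galFixing_embField_self γ⟩
      left_inv := fun _ => rfl
      right_inv := fun _ => rfl
      map_mul' := fun _ _ => rfl }
  -- the field-level transfer, pulled back to `U` along `e`
  haveI hfi : (absGaloisRestrict F E).range.FiniteIndex := Subgroup.finiteIndex_of_finite_quotient
  have h1 : absGaloisTransfer F E (h₀ : absoluteGaloisGroup F) =
      MonoidHom.transfer (absGaloisRangeAbProj F E) (e h₀) := rfl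
  haveI := finiteIndex_comap_mulEquiv e (absGaloisRestrict F E).range
  rw [h1, transfer_comp_mulEquiv e (absGaloisRangeAbProj F E) h₀]
  -- the subgroup-level transfer, pushed to `Γ_E^ab` along `ê`
  haveI := finiteIndex_subgroupOf (isOpen_galFixing F (embField F F)) (isOpen_galFixing F (embField F E))
    (U := galFixing F (embField F F)) (V := galFixing F (embField F E))
  have h2 : absGaloisAbProj E (liftGal F E h₁.2) = ê (QuotientGroup.mk h₁) := by
    rw [hê, hΦ]
    rfl
  have h3 : ê (QuotientGroup.mk h₁) =
      MonoidHom.transfer (ê.toMonoidHom.comp (toAbelianizationOfLe hle)) h₀ := by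
    rw [← hver]
    exact map_transfer (toAbelianizationOfLe hle) ê.toMonoidHom h₀
  rw [h2, h3]
  -- compare the two transfers on `U`: equal subgroups, equal homomorphisms
  symm
  refine transfer_congr_of_eq ?_ _ _ (fun x hx => ?_) h₀
  · ext x
    rw [Subgroup.mem_subgroupOf, Subgroup.mem_comap, galFixing_embField_eq_range F E]
    rfl
  · -- `ê [x] = [liftGal x] = ϕ_E (x)`
    have hxV : (x : absoluteGaloisGroup F) ∈ galFixing F (embField F E) := Subgroup.mem_subgroupOf.mp hx
    have hl : ê (toAbelianizationOfLe hle ⟨x, hx⟩) = absGaloisAbProj E (liftGal F E hxV) := by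
      change ê (QuotientGroup.mk (⟨(x : absoluteGaloisGroup F), hxV⟩ : galFixing F (embField F E))) = _
      rw [hê, hΦ]
      rfl
    rw [MonoidHom.comp_apply, MulEquiv.coe_toMonoidHom, hl, MonoidHom.comp_apply]
    symm
    exact absGaloisRangeAbProj_eq_of_eq (absGaloisRestrict_liftGal F E hxV)

end Transfers

/-! ### Neukirch IV (5.9) in the self presentation -/

section Theta

variable (F E : Type*) [Field F] [ValuativeRel F] [TopologicalSpace F] [IsNonarchimedeanLocalField F]
  [CharZero F] [Field E] [Algebra F E] [FiniteDimensional F E] [Algebra.IsSeparable F E]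
  [ValuativeRel E] [TopologicalSpace E] [IsNonarchimedeanLocalField E] [ValuativeExtension F E]
  [ValuativeExtension F F] [ValuativeExtension E E]

omit [ValuativeRel F] [TopologicalSpace F] [IsNonarchimedeanLocalField F] [CharZero F] [FiniteDimensional F E]
  [ValuativeRel E] [TopologicalSpace E] [IsNonarchimedeanLocalField E] [ValuativeExtension F E]
  [ValuativeExtension F F] [ValuativeExtension E E] in
/-- Reading `u ∈ Fˣ` at the trivial level and then in `E₀` is reading `u ∈ Eˣ` in `E₀`:
`(E ≃ E₀)⁻¹ (incl ((F ≃ F₀) u)) = u` in `E`. [cite: NeukirchANT1999, Ch. IV §5, Prop. (5.9)] -/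
theorem equivEmbField_symm_inclusion_self (u : Fˣ) :
    Units.map ((equivEmbField F E).symm : embField F E →* E)
        (Units.map (IntermediateField.inclusion (embField_self_le (embField F E)) :
            embField F F →* embField F E)
          (Units.map (equivEmbField F F : F →* embField F F) u)) =
      Units.map (algebraMap F E : F →* E) u := by
  ext
  simp only [Units.coe_map, MonoidHom.coe_coe]
  have hval : ((IntermediateField.inclusion (embField_self_le (embField F E)) (equivEmbField F F (u : F)) :
      embField F E) : AlgebraicClosure F) = algebraMap F (AlgebraicClosure F) (u : F) := by
    change ((equivEmbField F F (u : F) : embField F F) : AlgebraicClosure F) = _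
    rw [coe_embField_self, AlgEquiv.symm_apply_apply]
  have hincl : IntermediateField.inclusion (embField_self_le (embField F E)) (equivEmbField F F (u : F)) =
      algebraMap F (embField F E) (u : F) := Subtype.ext hval
  rw [hincl, AlgEquiv.commutes]

/-- **Neukirch IV (5.9) in the self presentation: `Ver_{E/F} (θ_F u) = θ_E (u)`.**  For a finite
separable extension `E/F` of non-archimedean local fields of characteristic `0`, the field-level
Verlagerung `Ver_{E/F} : Γ_F^ab → Γ_E^ab` along `res : Γ_E ↪ Γ_F` carries Serre's reciprocity map of `F`
to that of `E` composed with `Fˣ ⊆ Eˣ`, where `θ_k := (isReciprocitySystemE (F := k) (E := k) (isClassFieldTheory_localWeilDatum k)).theta`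
is each field's CANONICAL reciprocity map in its own Weil datum (abc-iut-L4-d3's convention).
Proof: the local transfer theorem inside `Γ_F` (`verlagerung_apply_eq_of_characterized`, levels
`F₀ ≤ E₀`) for the characterised Artin maps of `exists_reciprocity_characterized_embField_general`, read through
`levelArt_eq_mk_iff_theta` (they ARE `θ` transported), `absGaloisAbProj_liftGal_self'`,
`absGaloisTransfer_eq_of_transfer_mk` (the two Verlagerungen agree) and the base independence
`LocalWeilDatum.theta_recSystemE_eq_self` (`θ_E` over `F` = `θ_E` over `E`).
[cite: NeukirchANT1999, Ch. IV §5, Prop. (5.9)] -/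
theorem verlagerung_canonicalTheta (u : Fˣ) :
    Literature.NumberTheory.GaloisRepresentations.verlagerung F E
        ((isReciprocitySystemE (F := F) (E := F) (isClassFieldTheory_localWeilDatum F)).theta u) =
      (isReciprocitySystemE (F := E) (E := E) (isClassFieldTheory_localWeilDatum E)).theta
        (Units.map (algebraMap F E : F →* E) u) := by
  classical
  haveI : CompactSpace (absoluteGaloisGroup F) := absoluteGaloisGroup_compactSpace F
  haveI := finiteDimensional_embField F E
  haveI := finiteDimensional_embField F F
  have hle : embField F F ≤ embField F E := embField_self_le (embField F E)
  -- the characterised Artin maps at the levels `F₀` and `E₀`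
  obtain ⟨ArtF, -, -, hcharF, -, -⟩ := exists_reciprocity_characterized_embField_general F F
  obtain ⟨ArtE, -, -, hcharE, -, -⟩ := exists_reciprocity_characterized_embField_general F E
  set u₀ : (embField F F)ˣ := Units.map (equivEmbField F F : F →* embField F F) u with hu₀
  -- (5.9) inside `Γ_F`
  have key := verlagerung_apply_eq_of_characterized F F E hle ArtF ArtE hcharF hcharE u₀
  -- representatives
  obtain ⟨h₀, hh₀⟩ := QuotientGroup.mk_surjective (ArtF u₀)
  obtain ⟨h₁, hh₁⟩ := QuotientGroup.mk_surjective
    (verlagerung (isOpen_galFixing F (embField F F)) (isOpen_galFixing F (embField F E))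
      (galFixing_antitone F hle) (ArtF u₀))
  -- `θ_F u = [h₀]`
  have hF : absGaloisAbProj F (h₀ : absoluteGaloisGroup F) =
      (isReciprocitySystemE (F := F) (E := F) (isClassFieldTheory_localWeilDatum F)).theta u := by
    have h := (levelArt_eq_mk_iff_theta hcharF u₀ h₀).mp hh₀.symm
    rw [absGaloisAbProj_liftGal_self'] at h
    rw [h, hu₀]
    congr 1
    ext
    simp
  -- `θ_E (u) = [liftGal h₁]` (θ_E over F, then over E)
  have hE : absGaloisAbProj E (liftGal F E h₁.2) =
      (isReciprocitySystemE (F := E) (E := E) (isClassFieldTheory_localWeilDatum E)).theta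
        (Units.map (algebraMap F E : F →* E) u) := by
    have hArt : ArtE (Units.map (IntermediateField.inclusion hle : embField F F →* embField F E) u₀) =
        QuotientGroup.mk h₁ := by rw [← key, hh₁]
    have h := (levelArt_eq_mk_iff_theta hcharE _ h₁).mp hArt
    rw [h, hu₀, equivEmbField_symm_inclusion_self, LocalWeilDatum.theta_recSystemE_apply_eq_self]
  -- the two Verlagerungen agree
  have hver : transferToAbelianization (isOpen_galFixing F (embField F F)) (isOpen_galFixing F (embField F E))
      (galFixing_antitone F (embField_self_le (embField F E))) h₀ = QuotientGroup.mk h₁ := by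
    rw [← verlagerung_mk, hh₀, hh₁]
  rw [← hF, ← hE, verlagerung_absGaloisAbProj]
  exact absGaloisTransfer_eq_of_transfer_mk F E h₀ h₁ hver

/-- **The same on the profinite completions** (square (S3) of «COR110ib-OPEN», in abc-iut-L4-d3's binder
shapes): for any continuous `Ψ : (Fˣ)^∧ → (Eˣ)^∧` over `Fˣ ⊆ Eˣ` (`Ψ ∘ η = η ∘ incl`) and any topological
isomorphisms `e_F : (Fˣ)^∧ ⥲ Γ_F^ab`, `e_E : (Eˣ)^∧ ⥲ Γ_E^ab` extending the canonical reciprocity maps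
(`e ∘ η = θ`, as produced by `Cor110Nat.exists_completionEquiv_comp_eta_eq`), the square
`e_E (Ψ x) = Ver_{E/F} (e_F x)` commutes on all of `(Fˣ)^∧` — on `η(Fˣ)` it is
`verlagerung_canonicalTheta`, and `η(Fˣ)` is dense (`ProfiniteCompletion.denseRange`), all maps continuous.
[cite: MochizukiAbsTopIII2015, Cor 1.10 (i) p.42] -/
theorem completionEquiv_verlagerung
    {Ψ : ProfiniteGrp.ProfiniteCompletion.completion (GrpCat.of Fˣ) →ₜ*
      ProfiniteGrp.ProfiniteCompletion.completion (GrpCat.of Eˣ)}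
    (hΨ : ∀ u : Fˣ, Ψ (ProfiniteGrp.ProfiniteCompletion.etaFn (GrpCat.of Fˣ) u) =
      ProfiniteGrp.ProfiniteCompletion.etaFn (GrpCat.of Eˣ) (Units.map (algebraMap F E : F →* E) u))
    {eF : ProfiniteGrp.ProfiniteCompletion.completion (GrpCat.of Fˣ) ≃ₜ* absoluteGaloisGroupAbelianization F}
    (heF : ∀ u : Fˣ, eF (ProfiniteGrp.ProfiniteCompletion.etaFn (GrpCat.of Fˣ) u) =
      (isReciprocitySystemE (F := F) (E := F) (isClassFieldTheory_localWeilDatum F)).theta u)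
    {eE : ProfiniteGrp.ProfiniteCompletion.completion (GrpCat.of Eˣ) ≃ₜ* absoluteGaloisGroupAbelianization E}
    (heE : ∀ v : Eˣ, eE (ProfiniteGrp.ProfiniteCompletion.etaFn (GrpCat.of Eˣ) v) =
      (isReciprocitySystemE (F := E) (E := E) (isClassFieldTheory_localWeilDatum E)).theta v)
    (x : ProfiniteGrp.ProfiniteCompletion.completion (GrpCat.of Fˣ)) :
    eE (Ψ x) = Literature.NumberTheory.GaloisRepresentations.verlagerung F E (eF x) := by
  haveI : T2Space (absoluteGaloisGroupAbelianization E) := by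
    haveI : IsClosed ((commutator (absoluteGaloisGroup E)).topologicalClosure :
        Set (absoluteGaloisGroup E)) := Subgroup.isClosed_topologicalClosure _
    infer_instance
  have hdense := ProfiniteGrp.ProfiniteCompletion.denseRange (GrpCat.of Fˣ)
  have hc₁ : Continuous fun y => eE (Ψ y) := eE.continuous.comp Ψ.continuous
  have hc₂ : Continuous fun y => Literature.NumberTheory.GaloisRepresentations.verlagerung F E (eF y) :=
    (Literature.NumberTheory.GaloisRepresentations.verlagerung F E).continuous.comp eF.continuous
  have heq := hdense.equalizer hc₁ hc₂ (funext fun u => by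
    change eE (Ψ (ProfiniteGrp.ProfiniteCompletion.etaFn (GrpCat.of Fˣ) u)) =
      Literature.NumberTheory.GaloisRepresentations.verlagerung F E
        (eF (ProfiniteGrp.ProfiniteCompletion.etaFn (GrpCat.of Fˣ) u))
    rw [hΨ, heE, heF, verlagerung_canonicalTheta])
  exact congrFun heq x

end Theta

end Literature.AnabelianGeometry.AbsoluteAnabelian
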